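import Mathlib.AlgebraicGeometry.AffineScheme
import HarnessLib

/-!
# Spreading finitely many germs to sections over an affine neighbourhood

Topic: `Literature/AlgebraicGeometry/Resolution`. Elementary bookkeeping on stalks of a scheme:
finitely many germs at a point `x` are the germs of sections over ONE affine open
neighbourhood of `x`, which may be chosen inside any given neighbourhood
(`exists_affineOpen_sections_of_germs`); a section whose germ is a unit is a unit on a smaller
affine neighbourhood (`exists_affineOpen_isUnit_of_isUnit_germ`). Used to spread the Giraud
normal form of the radicand and the boundary equations from the stalk `𝒪_{W,w}` to an affine
chart around `w` in the endgame of the crux `PicoverLocalModel`.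

Sources: folklore (EGA 0_I, (4.1)).
-/

noncomputable section

open CategoryTheory AlgebraicGeometry TopologicalSpace Opposite

namespace Literature.AlgebraicGeometry.Resolution

universe u

/-- Finitely many germs at `x` are the germs of sections over one open neighbourhood of `x`
inside a given neighbourhood `U₀`. [folklore] -/
theorem exists_open_sections_of_germs (X : Scheme.{u}) (x : X) :
    ∀ (n : ℕ) (f : Fin n → X.presheaf.stalk x) (U₀ : X.Opens) (_ : x ∈ U₀),
      ∃ (U : X.Opens) (hxU : x ∈ U) (_ : U ≤ U₀) (s : Fin n → Γ(X, U)),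
        ∀ k, X.presheaf.germ U x hxU (s k) = f k := by
  intro n
  induction n with
  | zero =>
    intro f U₀ hx
    exact ⟨U₀, hx, le_rfl, Fin.elim0, fun k => k.elim0⟩
  | succ n ih =>
    intro f U₀ hx
    obtain ⟨U, hxU, hUU₀, s, hs⟩ := ih (fun k => f k.castSucc) U₀ hx
    obtain ⟨V, hxV, t, ht⟩ := X.presheaf.exists_germ_eq (f (Fin.last n))
    refine ⟨U ⊓ V, ⟨hxU, hxV⟩, inf_le_left.trans hUU₀,
      Fin.lastCases (X.presheaf.map (homOfLE inf_le_right).op t)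
        (fun k => X.presheaf.map (homOfLE inf_le_left).op (s k)), fun k => ?_⟩
    induction k using Fin.lastCases with
    | last =>
      simp only [Fin.lastCases_last]
      rw [TopCat.Presheaf.germ_res_apply, ht]
    | cast k =>
      simp only [Fin.lastCases_castSucc]
      rw [TopCat.Presheaf.germ_res_apply, hs]

/-- **Finitely many germs at `x` are the germs of sections over one AFFINE open neighbourhood
of `x`**, inside a given neighbourhood `U₀`. [folklore] -/
theorem exists_affineOpen_sections_of_germs (X : Scheme.{u}) (x : X) {n : ℕ}
    (f : Fin n → X.presheaf.stalk x) (U₀ : X.Opens) (hx : x ∈ U₀) :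
    ∃ (U : X.affineOpens) (hxU : x ∈ (U : X.Opens)) (_ : (U : X.Opens) ≤ U₀)
      (s : Fin n → Γ(X, (U : X.Opens))), ∀ k, X.presheaf.germ (U : X.Opens) x hxU (s k) = f k := by
  obtain ⟨U, hxU, hUU₀, s, hs⟩ := exists_open_sections_of_germs X x n f U₀ hx
  obtain ⟨V, hV, hxV, hVU⟩ := exists_isAffineOpen_mem_and_subset hxU
  refine ⟨⟨V, hV⟩, hxV, fun y hy => hUU₀ (hVU hy),
    fun k => X.presheaf.map (homOfLE (fun y hy => hVU hy)).op (s k), fun k => ?_⟩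
  rw [TopCat.Presheaf.germ_res_apply, hs]

/-- A section whose germ at `x` is a unit restricts to a unit over an affine neighbourhood of
`x` (the basic open of the section, refined to an affine). [folklore] -/
theorem exists_affineOpen_isUnit_of_isUnit_germ (X : Scheme.{u}) {x : X} {U : X.Opens}
    (hxU : x ∈ U) (f : Γ(X, U)) (hf : IsUnit (X.presheaf.germ U x hxU f)) :
    ∃ (V : X.affineOpens) (_ : x ∈ (V : X.Opens)) (hVU : (V : X.Opens) ≤ U),
      IsUnit (X.presheaf.map (homOfLE hVU).op f) := by
  have hxB : x ∈ X.basicOpen f := (X.mem_basicOpen f x hxU).mpr hf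
  obtain ⟨V, hV, hxV, hVB⟩ := exists_isAffineOpen_mem_and_subset hxB
  have hVB' : V ≤ X.basicOpen f := fun y hy => hVB hy
  refine ⟨⟨V, hV⟩, hxV, hVB'.trans (X.basicOpen_le f), ?_⟩
  refine X.toRingedSpace.isUnit_of_isUnit_germ V _ fun y hy => ?_
  change IsUnit (X.presheaf.germ V y hy (X.presheaf.map (homOfLE (hVB'.trans (X.basicOpen_le f))).op f))
  rw [TopCat.Presheaf.germ_res_apply]
  exact (X.mem_basicOpen f y _).mp (hVB' hy)

end Literature.AlgebraicGeometry.Resolution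

end
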